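/-
Copyright (c) 2026. All rights reserved.
Released under Apache 2.0 license as described in the file LICENSE.
-/
import Literature.AlgebraicGeometry.ComplexMultiplication.HyperellipticJacobianFourTimesPrimeLevel
import HarnessLib

/-!
# The first exceptional level: `J_{20} ∼ X_4 × (X_5 × X_{10}) × X_{20}`, `X_{20} ∼ Y_{20}⁴`, has
# `End⁰(J_{20}) ≅ ℚ(i) × Mat₂(ℚ(ζ_5)) × Mat₄(ℚ(√−5))`, of dimension `50`, `dim J_{20} = 9`; and `i ∉ ℚ(√−5), ℚ(√−6)`:
# `X_4, Y_{12}, Y_{28}, … ⟂ Y_{20}, Y_{24}`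

Layer `Literature/AlgebraicGeometry/ComplexMultiplication`, namespace `…ComplexMultiplication.HyperellipticJacobian`; the sequel of
`HyperellipticJacobianCrossLevelOrthogonality` (F12: reflex fields are `Hom`-invariants; roots of unity in them),
`HyperellipticJacobianReflexFields` (F10: `K*(Φ_{20}) = ℚ(x r)`, `(x r)² = −5`; `K*(Φ_{24})`, `(x r)² = −6`),
`HyperellipticJacobianEndomorphismAlgebras` (F9: `End⁰(X_{20}) ≅ Mat₄(ℚ(√−5))`) and `HyperellipticJacobianFourTimesPrimeLevel` (F13: the
assembly pattern at `m = 4p`).  THEOREMS ONLY (no definition, no named fact, no `sorry`, no instance).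

## The print

A. Gallese, H. Goodson, D. Lombardo, arXiv:2405.20394 [GalleseGoodsonLombardo2024] (held `paper:arxiv-2405.20394`, p0012, p0014–p0015): THM. 3.0
(6) «if `d = 20, 24, 60`, then `X_d ∼ Y_d⁴`», last statement «all `X_d` with odd `d` and all `Y_d` are pairwise non-isogenous»; §3.4 «Both
elliptic curves `E, E′` have CM by `ℤ[√−5]` … `ℚ(√−5)` is the CM field of (any variety isogenous to) `Y_{20}`», «the CM field of the
elliptic curve `Y_{24}` is `ℚ(√−6)`»; §3.5 LEMMA 14 (3) `End⁰(X_{20}) = Mat₄(F_{20})`, and the sentence after Lemma 14.  For `m = 20` the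
divisors `d ∉ {1,2}` are `4, 5, 10, 20`: `J_{20} ∼ X_4 × X_5 × X_{10} × X_{20} ∼ X_4 × X_5² × Y_{20}⁴`, so — once `X_4 ⟂ Y_{20}` (`i ∉ ℚ(√−5)`),
`X_5, X_{10} ⟂ X_{20}` and `X_4 ⟂ X_5, X_{10}` (F12) — `End⁰(J_{20}) ≅ ℚ(i) × Mat₂(ℚ(ζ_5)) × Mat₄(ℚ(√−5))`, of dimension `2 + 16 + 32 = 50`,
and `dim J_{20} = 1 + 4 + 4 = 9 = g(C_{20})`.

## What is proved

* §1 (`i ∉ ℚ(√−n)` for `n` not a square): private `sq_ne_neg_one_of_mem_adjoin` — for `w ∈ ℂ` with `w² = −n`, `n ∈ ℕ` not a square, no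
  element of `ℚ(w) ⊂ ℂ` squares to `−1` (`y = a + b w` on the power basis; `a² − n b² + 1 + 2ab·w = 0` forces `n b² = 1` or `a² = −1` or
  `−n B² = A²`); `not_isPrimitiveRoot_four_of_mem_traceField_twenty ∕ _twentyFour` (`i ∉ K*(Φ_{20}) = ℚ(√−5)`, `i ∉ K*(Φ_{24}) = ℚ(√−6)`);
  **`orthogonal_four_twenty`**, `orthogonal_four_twentyFour` (`X_4 ⟂ Y_{20}, Y_{24}`); **`orthogonal_fourDvd_twenty_of_not_eight_dvd`**,
  `orthogonal_fourDvd_twentyFour_of_not_eight_dvd` (`Y_d ⟂ Y_{20}, Y_{24}` for `d ≡ 4 (mod 8)`, `d ≥ 12`, `d ∉ {20, 60}` — e.g. `Y_{12}, Y_{28}`).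
* §2 `hom_eq_zero_blocks_twenty` (the blocks `A₄`, `A₅ ⊕ A₁₀`, `A₂₀` are pairwise orthogonal),
  **`nonempty_endAlgebra_algEquiv_twentyJacobian`** (`End⁰(J) ≃ₐ[ℚ] ℚ(ζ_4) × (Mat₂(ℚ(ζ_5)) × Mat₄(ℚ(r)))`, `r = ζ + ζ³ + ζ⁷ + ζ⁹`, `r² = −5`),
  **`finrank_endAlgebra_twentyJacobian`** (`dim_ℚ End⁰(J) = 50`, `dim J = 9`).

## Honest column ∕ NOT here

The curve; `Y_{20}` vs `Y_8` (`ℚ(√−5)` vs `ℚ(√−2)`), `Y_{20}` vs `Y_{24}`, `X_3` vs `Y_{24}`, `X_3, X_5` vs `Y_{60}` remain untyped (F12's honest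
column, now shorter).  `HC_CM` is not touched.

## References

* [GalleseGoodsonLombardo2024] A. Gallese, H. Goodson, D. Lombardo, arXiv:2405.20394 — §3 Thm. 3.0 ((6), last statement), §3.4, §3.5 Lemma 14 (3)
  and the sentence following it.
* [MumfordAV1970] D. Mumford, *Abelian Varieties* — §19 Thm. 3 Cor. 1–2, p. 174.
* [Shimura1998] G. Shimura — §5.1 Prop. 3, Prop. 6, §8.3 Prop. 28.
* [MilneCM2006] J. S. Milne — Ch. I §1 Prop. 1.18 (c), §3 Prop. 3.13.

## Provenance

Cell `pub-hodgecm2` (COR-CM), KEPT Literature lane `lit-deligne-3` gen 51 (claim GGL24-LEVEL-TWENTY; count-neutral, own lane).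
-/

noncomputable section

open CategoryTheory CategoryTheory.Limits NumberField Module Polynomial

namespace Literature.AlgebraicGeometry.ComplexMultiplication

open Literature.AlgebraicGeometry.Motives
open Literature.AlgebraicGeometry.HodgeTheory (complexBetti)
open Literature.NumberTheory.ComplexMultiplication

namespace HyperellipticJacobian

open Literature.AlgebraicGeometry.Pohlmann1968 Literature.AlgebraicGeometry.Pohlmann1968.Cyclotomic

/-! ## §1 `i ∉ ℚ(√−n)`; `X_4, Y_{4(2k+1)} ⟂ Y_{20}, Y_{24}` -/

section SqrtNeg

/-- **No element of `ℚ(w) ⊂ ℂ`, `w² = −n` with `n ∈ ℕ` not a square, squares to `−1`** (`ℚ(√−n) ∌ i`): writing `y = a + b·w` on the power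
basis `{1, w}`, `y² = −1` gives `(a² − n b² + 1) + 2ab·w = 0`; `2ab = 0` forces `a² = −1` or `n b² = 1` (`n` a square), and `2ab ≠ 0` forces
`w ∈ ℚ` with `−n (2ab)² = (a² − n b² + 1)²`, i.e. `n = 0`. [folklore] -/
private theorem sq_ne_neg_one_of_mem_adjoin {w : ℂ} {n : ℕ} (hw : w ^ 2 = -(n : ℂ)) (hn : ¬ IsSquare n) {y : ℂ}
    (hy : y ∈ IntermediateField.adjoin ℚ {w}) : y ^ 2 ≠ -1 := by
  intro hy2
  -- `w` is integral, `ℚ(w)` has a power basis of dimension `≤ 2`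
  have hroot : aeval w (X ^ 2 + C (n : ℚ) : ℚ[X]) = 0 := by
    simp [hw]
  have hint : IsIntegral ℚ w := ⟨X ^ 2 + C (n : ℚ), monic_X_pow_add_C _ two_ne_zero, by simpa using hroot⟩
  let pb := IntermediateField.adjoin.powerBasis hint
  have hdim : pb.dim ≤ 2 := by
    have h := minpoly.degree_le_of_ne_zero (A := ℚ) (x := w) (p := X ^ 2 + C (n : ℚ))
      (Monic.ne_zero (monic_X_pow_add_C _ two_ne_zero)) hroot
    rw [degree_X_pow_add_C two_pos] at h
    have h' : (minpoly ℚ w).natDegree ≤ 2 := natDegree_le_iff_degree_le.2 h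
    simpa [pb] using h'
  -- `y = a + b w`
  obtain ⟨f, hf, hyf⟩ := pb.exists_eq_aeval ⟨y, hy⟩
  have hf1 : f.natDegree ≤ 1 := by omega
  set a : ℚ := f.coeff 0 with ha
  set b : ℚ := f.coeff 1 with hb
  have hyab : y = (a : ℂ) + (b : ℂ) * w := by
    have h := congrArg (fun z : IntermediateField.adjoin ℚ {w} => (z : ℂ)) hyf
    simp only at h
    rw [eq_X_add_C_of_natDegree_le_one hf1] at h
    rw [h]
    simp [pb, map_add, map_mul, aeval_C, aeval_X, ← ha, ← hb]
    ring
  -- the relation `(a² − n b² + 1) + 2ab·w = 0`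
  have hrel : ((a ^ 2 - n * b ^ 2 + 1 : ℚ) : ℂ) + ((2 * a * b : ℚ) : ℂ) * w = 0 := by
    have h1 : ((a : ℂ) + (b : ℂ) * w) ^ 2 = -1 := by rw [← hyab]; exact hy2
    push_cast
    linear_combination h1 - (b : ℂ) ^ 2 * hw
  by_cases hB : (2 * a * b : ℚ) = 0
  · -- then `a² − n b² + 1 = 0` with `a = 0` or `b = 0`
    have hA : (a ^ 2 - n * b ^ 2 + 1 : ℚ) = 0 := by
      rw [hB] at hrel
      push_cast at hrel
      have h : ((a ^ 2 - n * b ^ 2 + 1 : ℚ) : ℂ) = 0 := by push_cast; linear_combination hrel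
      exact_mod_cast h
    rcases mul_eq_zero.1 hB with hab | hb0
    · rcases mul_eq_zero.1 hab with h2 | ha0
      · norm_num at h2
      · -- `a = 0`: `n b² = 1`, so `n = (n b)²` is a square
        rw [ha0] at hA
        have hnb : (n : ℚ) * b ^ 2 = 1 := by linarith
        have hsq : IsSquare (n : ℚ) := ⟨n * b, by linear_combination (-(n : ℚ)) * hnb⟩
        exact hn (Rat.isSquare_natCast_iff.1 hsq)
    · -- `b = 0`: `a² = −1`
      rw [hb0] at hA
      nlinarith [sq_nonneg a]
  · -- `2ab ≠ 0`: `w = −A/B` is rational, `B² w² = A²`, `−n B² = A²`, so `n = 0` — a square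
    have hBw : ((2 * a * b : ℚ) : ℂ) * w = -((a ^ 2 - n * b ^ 2 + 1 : ℚ) : ℂ) := by linear_combination hrel
    have hsqC : ((2 * a * b : ℚ) : ℂ) ^ 2 * w ^ 2 = ((a ^ 2 - n * b ^ 2 + 1 : ℚ) : ℂ) ^ 2 := by
      rw [← mul_pow, hBw, neg_sq]
    rw [hw] at hsqC
    have hsqQ : (2 * a * b : ℚ) ^ 2 * (-(n : ℚ)) = (a ^ 2 - n * b ^ 2 + 1 : ℚ) ^ 2 := by exact_mod_cast hsqC
    have hB2 : 0 < (2 * a * b : ℚ) ^ 2 := by positivity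
    have hn0 : (n : ℚ) ≤ 0 := by nlinarith [sq_nonneg (a ^ 2 - n * b ^ 2 + 1 : ℚ)]
    have hn0' : n = 0 := by exact_mod_cast le_antisymm hn0 (Nat.cast_nonneg n)
    exact hn ⟨0, by rw [hn0']⟩

/-- `5` is not a square. [folklore] -/
private theorem not_isSquare_five : ¬ IsSquare (5 : ℕ) := by
  rintro ⟨t, ht⟩
  have : t ≤ 2 := by nlinarith
  interval_cases t <;> omega

/-- `6` is not a square. [folklore] -/
private theorem not_isSquare_six : ¬ IsSquare (6 : ℕ) := by
  rintro ⟨t, ht⟩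
  have : t ≤ 2 := by nlinarith
  interval_cases t <;> omega

/-- A primitive `4`-th root of unity squares to `−1`. [folklore] -/
private theorem sq_eq_neg_one_of_isPrimitiveRoot_four {y : ℂ} (hy : IsPrimitiveRoot y 4) : y ^ 2 = -1 := by
  have h4 : (y ^ 2) ^ 2 = 1 := by rw [← pow_mul]; exact hy.pow_eq_one
  rcases sq_eq_one_iff.1 h4 with h | h
  · exact absurd h (hy.pow_ne_one_of_pos_of_lt (by norm_num) (by norm_num))
  · exact h

variable {K : Type} [Field K] [NumberField K]

/-- **`i ∉ K*(Φ_{20}) = ℚ(√−5)`**: the reflex field of the lower-half type at level `20` contains no primitive `4`-th root of unity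
(`K* = ℚ(x r)`, `(x r)² = −5`, F10; `5` is not a square). [cite: GalleseGoodsonLombardo2024, §3.4 («ℚ(√−5) is the CM field of … Y_{20}»)]
[cite: Shimura1998, §8.3 Prop. 28] -/
theorem not_isPrimitiveRoot_four_of_mem_traceField_twenty [IsCyclotomicExtension {20} ℚ K] (Φ : CMType K)
    (hΦ : ∀ σ : K →+* ℂ, σ ∈ Φ.1 ↔ 2 * (expOf 20 K σ).val < 20) {y : ℂ} (hy : y ∈ traceField Φ) :
    ¬ IsPrimitiveRoot y 4 := by
  intro hy4
  obtain ⟨x⟩ := (inferInstance : Nonempty (K →+* ℂ))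
  obtain ⟨htr, hsq, -, -⟩ := traceField_twenty Φ hΦ x
  rw [htr] at hy
  have hw : (x (zetaOf 20 K + zetaOf 20 K ^ 3 + zetaOf 20 K ^ 7 + zetaOf 20 K ^ 9)) ^ 2 = -((5 : ℕ) : ℂ) := by
    rw [hsq]; norm_num
  exact sq_ne_neg_one_of_mem_adjoin hw not_isSquare_five hy (sq_eq_neg_one_of_isPrimitiveRoot_four hy4)

/-- **`i ∉ K*(Φ_{24}) = ℚ(√−6)`** (`(x r)² = −6`; `6` is not a square). [cite: GalleseGoodsonLombardo2024, §3.4 («the CM field of Y_{24} is ℚ(√−6)»)]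
[cite: Shimura1998, §8.3 Prop. 28] -/
theorem not_isPrimitiveRoot_four_of_mem_traceField_twentyFour [IsCyclotomicExtension {24} ℚ K] (Φ : CMType K)
    (hΦ : ∀ σ : K →+* ℂ, σ ∈ Φ.1 ↔ 2 * (expOf 24 K σ).val < 24) {y : ℂ} (hy : y ∈ traceField Φ) :
    ¬ IsPrimitiveRoot y 4 := by
  intro hy4
  obtain ⟨x⟩ := (inferInstance : Nonempty (K →+* ℂ))
  obtain ⟨htr, hsq, -, -⟩ := traceField_twentyFour Φ hΦ x
  rw [htr] at hy
  have hw : (x (zetaOf 24 K + zetaOf 24 K ^ 5 + zetaOf 24 K ^ 7 + zetaOf 24 K ^ 11)) ^ 2 = -((6 : ℕ) : ℂ) := by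
    rw [hsq]; norm_num
  exact sq_ne_neg_one_of_mem_adjoin hw not_isSquare_six hy (sq_eq_neg_one_of_isPrimitiveRoot_four hy4)

variable {K₄ : Type} [Field K₄] [NumberField K₄] [IsCyclotomicExtension {4} ℚ K₄] {Φ₄ : CMType K₄}
  {A₄ : AbelianVariety ℂ} {ι₄ : 𝓞 K₄ →+* End A₄} {θ₄ : K₄ →+* Module.End ℂ (complexBetti A₄.X 1)}
  {Φ' : CMType K} {A' : AbelianVariety ℂ} {ι' : 𝓞 K →+* End A'} {θ' : K →+* Module.End ℂ (complexBetti A'.X 1)}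
  {d : ℕ} [NeZero d] {Kd : Type} [Field Kd] [NumberField Kd] [IsCyclotomicExtension {d} ℚ Kd] {Φd : CMType Kd}
  {Ad : AbelianVariety ℂ} {ιd : 𝓞 Kd →+* End Ad} {θd : Kd →+* Module.End ℂ (complexBetti Ad.X 1)}

/-- **`X_4 ⟂ Y_{20}`** (`i ∈ K*(Φ_4) = ℚ(i)`, `i ∉ K*(Φ_{20}) = ℚ(√−5)`): `Hom = 0` both ways, not isogenous, for all realisations.
[cite: GalleseGoodsonLombardo2024, §3 Thm. 3.0 (last statement) and §3.4] [cite: MilneCM2006, Ch. I §3 Prop. 3.13] -/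
theorem orthogonal_four_twenty [IsCyclotomicExtension {20} ℚ K] (hA₄ : IsCMTypeRealisation Φ₄ A₄ ι₄ θ₄)
    (hΦ' : ∀ σ : K →+* ℂ, σ ∈ Φ'.1 ↔ 2 * (expOf 20 K σ).val < 20) (hA' : IsCMTypeRealisation Φ' A' ι' θ') :
    (∀ u : A₄ ⟶ A', u = 0) ∧ (∀ v : A' ⟶ A₄, v = 0) ∧
      ¬ AbelianVariety.IsIsogenous A₄ A' ∧ ¬ AbelianVariety.IsIsogenous A' A₄ :=
  hA₄.orthogonal_of_isPrimitiveRoot hA' (exists_isPrimitiveRoot_four_mem_traceField_four Φ₄)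
    fun _ hy => not_isPrimitiveRoot_four_of_mem_traceField_twenty Φ' hΦ' hy

/-- **`X_4 ⟂ Y_{24}`** (`i ∉ ℚ(√−6)`). [cite: GalleseGoodsonLombardo2024, §3 Thm. 3.0 (last statement) and §3.4] [cite: MilneCM2006, Ch. I §3 Prop. 3.13] -/
theorem orthogonal_four_twentyFour [IsCyclotomicExtension {24} ℚ K] (hA₄ : IsCMTypeRealisation Φ₄ A₄ ι₄ θ₄)
    (hΦ' : ∀ σ : K →+* ℂ, σ ∈ Φ'.1 ↔ 2 * (expOf 24 K σ).val < 24) (hA' : IsCMTypeRealisation Φ' A' ι' θ') :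
    (∀ u : A₄ ⟶ A', u = 0) ∧ (∀ v : A' ⟶ A₄, v = 0) ∧
      ¬ AbelianVariety.IsIsogenous A₄ A' ∧ ¬ AbelianVariety.IsIsogenous A' A₄ :=
  hA₄.orthogonal_of_isPrimitiveRoot hA' (exists_isPrimitiveRoot_four_mem_traceField_four Φ₄)
    fun _ hy => not_isPrimitiveRoot_four_of_mem_traceField_twentyFour Φ' hΦ' hy

/-- **`Y_d ⟂ Y_{20}` for `d ≡ 4 (mod 8)`, `d ≥ 12`, `d ∉ {20, 60}`** (e.g. `Y_{12}, Y_{28}, Y_{36}`): `i ∈ K*(Φ_d)` (F12), `i ∉ ℚ(√−5)`.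
[cite: GalleseGoodsonLombardo2024, §3 Thm. 3.0 (last statement) and §3.4] [cite: MilneCM2006, Ch. I §3 Prop. 3.13] -/
theorem orthogonal_fourDvd_twenty_of_not_eight_dvd [IsCyclotomicExtension {20} ℚ K] (h4 : 4 ∣ d) (h8 : 8 ≤ d) (h20 : d ≠ 20)
    (h60 : d ≠ 60) (h8n : ¬ 8 ∣ d) (hΦd : ∀ σ : Kd →+* ℂ, σ ∈ Φd.1 ↔ 2 * (expOf d Kd σ).val < d) (hAd : IsCMTypeRealisation Φd Ad ιd θd)
    (hΦ' : ∀ σ : K →+* ℂ, σ ∈ Φ'.1 ↔ 2 * (expOf 20 K σ).val < 20) (hA' : IsCMTypeRealisation Φ' A' ι' θ') :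
    (∀ u : Ad ⟶ A', u = 0) ∧ (∀ v : A' ⟶ Ad, v = 0) ∧
      ¬ AbelianVariety.IsIsogenous Ad A' ∧ ¬ AbelianVariety.IsIsogenous A' Ad :=
  hAd.orthogonal_of_isPrimitiveRoot hA' (exists_isPrimitiveRoot_four_mem_traceField_of_not_eight_dvd h4 h8 h20 h60 h8n Φd hΦd)
    fun _ hy => not_isPrimitiveRoot_four_of_mem_traceField_twenty Φ' hΦ' hy

/-- **`Y_d ⟂ Y_{24}` for `d ≡ 4 (mod 8)`, `d ≥ 12`, `d ∉ {20, 60}`** (`i ∉ ℚ(√−6)`).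
[cite: GalleseGoodsonLombardo2024, §3 Thm. 3.0 (last statement) and §3.4] [cite: MilneCM2006, Ch. I §3 Prop. 3.13] -/
theorem orthogonal_fourDvd_twentyFour_of_not_eight_dvd [IsCyclotomicExtension {24} ℚ K] (h4 : 4 ∣ d) (h8 : 8 ≤ d) (h20 : d ≠ 20)
    (h60 : d ≠ 60) (h8n : ¬ 8 ∣ d) (hΦd : ∀ σ : Kd →+* ℂ, σ ∈ Φd.1 ↔ 2 * (expOf d Kd σ).val < d) (hAd : IsCMTypeRealisation Φd Ad ιd θd)
    (hΦ' : ∀ σ : K →+* ℂ, σ ∈ Φ'.1 ↔ 2 * (expOf 24 K σ).val < 24) (hA' : IsCMTypeRealisation Φ' A' ι' θ') :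
    (∀ u : Ad ⟶ A', u = 0) ∧ (∀ v : A' ⟶ Ad, v = 0) ∧
      ¬ AbelianVariety.IsIsogenous Ad A' ∧ ¬ AbelianVariety.IsIsogenous A' Ad :=
  hAd.orthogonal_of_isPrimitiveRoot hA' (exists_isPrimitiveRoot_four_mem_traceField_of_not_eight_dvd h4 h8 h20 h60 h8n Φd hΦd)
    fun _ hy => not_isPrimitiveRoot_four_of_mem_traceField_twentyFour Φ' hΦ' hy

end SqrtNeg

/-! ## §2 `End⁰(J_{20}) ≅ ℚ(i) × Mat₂(ℚ(ζ_5)) × Mat₄(ℚ(√−5))`, `dim_ℚ = 50`, `dim J_{20} = 9` -/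

section TwentyJacobian

variable {K₄ : Type} [Field K₄] [NumberField K₄] [IsCyclotomicExtension {4} ℚ K₄] {Φ₄ : CMType K₄}
  {A₄ : AbelianVariety ℂ} {ι₄ : 𝓞 K₄ →+* End A₄} {θ₄ : K₄ →+* Module.End ℂ (complexBetti A₄.X 1)}
  {K₅ : Type} [Field K₅] [NumberField K₅] [IsCyclotomicExtension {5} ℚ K₅] {Φ₅ : CMType K₅}
  {A₅ : AbelianVariety ℂ} {ι₅ : 𝓞 K₅ →+* End A₅} {θ₅ : K₅ →+* Module.End ℂ (complexBetti A₅.X 1)}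
  {L : Type} [Field L] [NumberField L] [IsCyclotomicExtension {2 * 5} ℚ L] {Ψ : CMType L}
  {A₁₀ : AbelianVariety ℂ} {ι₁₀ : 𝓞 L →+* End A₁₀} {θ₁₀ : L →+* Module.End ℂ (complexBetti A₁₀.X 1)}
  {K : Type} [Field K] [NumberField K] [IsCyclotomicExtension {20} ℚ K] {Φ' : CMType K}
  {A' : AbelianVariety ℂ} {ι' : 𝓞 K →+* End A'} {θ' : K →+* Module.End ℂ (complexBetti A'.X 1)}

/-- **The blocks `X_4`, `X_5 ⊕ X_{10}`, `X_{20}` of `J_{20}` are pairwise orthogonal** (F12: `X_4 ⟂ X_5, X_{10}` by the fifth roots of unity,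
`X_5, X_{10} ⟂ Y_{20}`; §1: `X_4 ⟂ Y_{20}`). [cite: GalleseGoodsonLombardo2024, §3 Thm. 3.0 (last statement)] [cite: MilneCM2006, Ch. I §3 Prop. 3.13] -/
theorem hom_eq_zero_blocks_twenty (hA₄ : IsCMTypeRealisation Φ₄ A₄ ι₄ θ₄)
    (hΦ₅ : ∀ σ : K₅ →+* ℂ, σ ∈ Φ₅.1 ↔ 2 * (expOf 5 K₅ σ).val < 5) (hA₅ : IsCMTypeRealisation Φ₅ A₅ ι₅ θ₅)
    (hΨ : ∀ σ : L →+* ℂ, σ ∈ Ψ.1 ↔ 2 * (expOf (2 * 5) L σ).val < 2 * 5) (hA₁₀ : IsCMTypeRealisation Ψ A₁₀ ι₁₀ θ₁₀)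
    (hΦ' : ∀ σ : K →+* ℂ, σ ∈ Φ'.1 ↔ 2 * (expOf 20 K σ).val < 20) (hA' : IsCMTypeRealisation Φ' A' ι' θ') :
    ∀ i j : Fin 3, i ≠ j →
      ∀ f : (![A₄, ⨁ fun l : Fin 2 => (![A₅, A₁₀] : Fin 2 → AbelianVariety ℂ) l, A'] : Fin 3 → AbelianVariety ℂ) i ⟶
        (![A₄, ⨁ fun l : Fin 2 => (![A₅, A₁₀] : Fin 2 → AbelianVariety ℂ) l, A'] : Fin 3 → AbelianVariety ℂ) j, f = 0 := by
  haveI : NeZero (5 : ℕ) := ⟨by norm_num⟩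
  haveI : NeZero (2 * 5 : ℕ) := ⟨by norm_num⟩
  have hodd : Odd 5 := by decide
  have h3 : 3 ≤ 5 := by norm_num
  have oA₄A := orthogonal_odd_four (Φ' := Φ₄) hodd h3 hΦ₅ hA₅ hA₄
  have oA₄A₂ := orthogonal_twiceOdd_four (Φ' := Φ₄) hodd h3 hΨ hA₁₀ hA₄
  have oA₄A' := orthogonal_four_twenty hA₄ hΦ' hA'
  have oAA' := orthogonal_odd_twenty hodd h3 hΦ₅ hA₅ hΦ' hA'
  have oA₂A' := orthogonal_twiceOdd_twenty hodd h3 hΨ hA₁₀ hΦ' hA'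
  have hinM : ∀ {Z : AbelianVariety ℂ}, (∀ u : Z ⟶ A₅, u = 0) → (∀ u : Z ⟶ A₁₀, u = 0) →
      ∀ f : Z ⟶ ⨁ fun l : Fin 2 => (![A₅, A₁₀] : Fin 2 → AbelianVariety ℂ) l, f = 0 := by
    intro Z h0 h1 f
    refine biproduct.hom_ext _ _ fun l => ?_
    rw [Limits.zero_comp]
    match l with
    | ⟨0, _⟩ => exact h0 _
    | ⟨1, _⟩ => exact h1 _
  have houtM : ∀ {Z : AbelianVariety ℂ}, (∀ u : A₅ ⟶ Z, u = 0) → (∀ u : A₁₀ ⟶ Z, u = 0) →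
      ∀ f : (⨁ fun l : Fin 2 => (![A₅, A₁₀] : Fin 2 → AbelianVariety ℂ) l) ⟶ Z, f = 0 := by
    intro Z h0 h1 f
    refine biproduct.hom_ext' _ _ fun l => ?_
    rw [Limits.comp_zero]
    match l with
    | ⟨0, _⟩ => exact h0 _
    | ⟨1, _⟩ => exact h1 _
  intro i j hij f
  match i, j with
  | ⟨0, _⟩, ⟨0, _⟩ => exact absurd rfl hij
  | ⟨1, _⟩, ⟨1, _⟩ => exact absurd rfl hij
  | ⟨2, _⟩, ⟨2, _⟩ => exact absurd rfl hij
  | ⟨0, _⟩, ⟨1, _⟩ => exact hinM oA₄A.2.1 oA₄A₂.2.1 f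
  | ⟨1, _⟩, ⟨0, _⟩ => exact houtM oA₄A.1 oA₄A₂.1 f
  | ⟨0, _⟩, ⟨2, _⟩ => exact oA₄A'.1 f
  | ⟨2, _⟩, ⟨0, _⟩ => exact oA₄A'.2.1 f
  | ⟨1, _⟩, ⟨2, _⟩ => exact houtM oAA'.1 oA₂A'.1 f
  | ⟨2, _⟩, ⟨1, _⟩ => exact hinM oAA'.2.1 oA₂A'.2.1 f

omit [IsCyclotomicExtension {4} ℚ K₄] in
/-- `[ℚ(ζ_4) : ℚ] = 2`. [folklore] -/
private theorem finrank_eq_two_four'' [IsCyclotomicExtension {4} ℚ K₄] : finrank ℚ K₄ = 2 := by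
  haveI : NeZero (4 : ℕ) := ⟨by norm_num⟩
  rw [IsCyclotomicExtension.finrank (K := ℚ) (n := 4) K₄ (Polynomial.cyclotomic.irreducible_rat (by norm_num))]
  decide +kernel

/-- The product of three algebras indexed by `Fin 3` (`∏_{i : Fin 3} T_i ≃ₐ T₀ × (T₁ × T₂)`). [folklore] -/
private theorem nonempty_pi_fin_three_algEquiv_prod' (T : Fin 3 → Type) [∀ i, Ring (T i)] [∀ i, Algebra ℚ (T i)] :
    Nonempty ((∀ i, T i) ≃ₐ[ℚ] T 0 × (T 1 × T 2)) := by
  refine ⟨AlgEquiv.ofBijective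
    ((Pi.evalAlgHom ℚ T 0).prod ((Pi.evalAlgHom ℚ T 1).prod (Pi.evalAlgHom ℚ T 2))) ⟨fun f g h => ?_, fun x => ?_⟩⟩
  · simp only [AlgHom.prod_apply, Pi.evalAlgHom_apply, Prod.mk.injEq] at h
    funext i
    match i with
    | ⟨0, _⟩ => exact h.1
    | ⟨1, _⟩ => exact h.2.1
    | ⟨2, _⟩ => exact h.2.2
  · exact ⟨Fin.cons x.1 (Fin.cons x.2.1 (Fin.cons x.2.2 finZeroElim)), rfl⟩

/-- **GGL THM. 3.0 + LEMMA 14 at the exceptional level `20`: `End⁰(J_{20}) ≃ₐ[ℚ] ℚ(ζ_4) × (Mat₂(ℚ(ζ_5)) × Mat₄(ℚ(r)))`**, `r = ζ + ζ³ + ζ⁷ + ζ⁹`,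
`r² = −5` (`F_{20} = ℚ(√−5)`), on the carrier `⨁_{Fin 3} ![A₄, A₅ ⊕ A₁₀, A₂₀]`: the blocks are pairwise orthogonal, `End⁰(A₄) = ℚ(ζ_4)`,
`End⁰(A₅ ⊕ A₁₀) ≅ Mat₂(ℚ(ζ_5))` (`X_{10} ∼ X_5`), `End⁰(A₂₀) ≅ Mat₄(ℚ(r))` (Lemma 14 (3), F9).
[cite: GalleseGoodsonLombardo2024, §3.5 Lemma 14 (3) and the sentence following it; §3 Thm. 3.0 (4), (6), last statement; §3.4]
[cite: MumfordAV1970, §19 Cor. 2 of Thm. 3 and p. 174] [cite: Shimura1998, §5.1 Prop. 3 (proof) and Prop. 6] -/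
theorem nonempty_endAlgebra_algEquiv_twentyJacobian (hA₄ : IsCMTypeRealisation Φ₄ A₄ ι₄ θ₄)
    (hΦ₅ : ∀ σ : K₅ →+* ℂ, σ ∈ Φ₅.1 ↔ 2 * (expOf 5 K₅ σ).val < 5) (hA₅ : IsCMTypeRealisation Φ₅ A₅ ι₅ θ₅)
    (hΨ : ∀ σ : L →+* ℂ, σ ∈ Ψ.1 ↔ 2 * (expOf (2 * 5) L σ).val < 2 * 5) (hA₁₀ : IsCMTypeRealisation Ψ A₁₀ ι₁₀ θ₁₀)
    (hΦ' : ∀ σ : K →+* ℂ, σ ∈ Φ'.1 ↔ 2 * (expOf 20 K σ).val < 20) (hA' : IsCMTypeRealisation Φ' A' ι' θ') :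
    Nonempty ((⨁ fun i : Fin 3 =>
        (![A₄, ⨁ fun l : Fin 2 => (![A₅, A₁₀] : Fin 2 → AbelianVariety ℂ) l, A'] : Fin 3 → AbelianVariety ℂ) i).endAlgebra ≃ₐ[ℚ]
      K₄ × (Matrix (Fin 2) (Fin 2) K₅ ×
        Matrix (Fin 4) (Fin 4) (IntermediateField.adjoin ℚ {zetaOf 20 K + zetaOf 20 K ^ 3 + zetaOf 20 K ^ 7 + zetaOf 20 K ^ 9}))) := by
  classical
  haveI : NeZero (5 : ℕ) := ⟨by norm_num⟩
  haveI : NeZero (2 * 5 : ℕ) := ⟨by norm_num⟩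
  have hodd : Odd 5 := by decide
  obtain ⟨E, -⟩ := AbelianVariety.nonempty_algEquiv_endAlgebra_biproduct_pi
    (A := fun i : Fin 3 => (![A₄, ⨁ fun l : Fin 2 => (![A₅, A₁₀] : Fin 2 → AbelianVariety ℂ) l, A'] : Fin 3 → AbelianVariety ℂ) i)
    (hom_eq_zero_blocks_twenty hA₄ hΦ₅ hA₅ hΨ hA₁₀ hΦ' hA')
  obtain ⟨P⟩ := nonempty_pi_fin_three_algEquiv_prod'
    (fun i : Fin 3 => ((![A₄, ⨁ fun l : Fin 2 => (![A₅, A₁₀] : Fin 2 → AbelianVariety ℂ) l, A'] : Fin 3 → AbelianVariety ℂ) i).endAlgebra)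
  obtain ⟨e₀⟩ : Nonempty (A₄.endAlgebra ≃ₐ[ℚ] K₄) :=
    hA₄.nonempty_endAlgebra_algEquiv_of_primitive (CMTypeLattice.primitive_of_finrank_eq_two Φ₄ finrank_eq_two_four'')
  obtain ⟨e₁⟩ : Nonempty ((⨁ fun l : Fin 2 => (![A₅, A₁₀] : Fin 2 → AbelianVariety ℂ) l).endAlgebra ≃ₐ[ℚ]
      Matrix (Fin 2) (Fin 2) K₅) := by
    obtain ⟨f₁⟩ := (isIsogenous_biproduct_pair (isIsogenous_twiceOdd hodd (by norm_num) hΨ hΦ₅ hA₁₀ hA₅)).nonempty_endAlgebra_algEquiv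
    obtain ⟨f₂⟩ := nonempty_matrix_algEquiv_endAlgebra_biproduct_const A₅ 2
    obtain ⟨f₃⟩ := nonempty_endAlgebra_algEquiv_odd hodd Φ₅ hΦ₅ hA₅
    exact ⟨(f₁.trans f₂.symm).trans f₃.mapMatrix⟩
  obtain ⟨-, -, -, ⟨e₂⟩, -⟩ := nonempty_matrix_four_algEquiv_endAlgebra_twenty Φ' hΦ' hA'
  exact ⟨(E.trans P).trans (AlgEquiv.prodCongr e₀ (AlgEquiv.prodCongr e₁ e₂.symm))⟩

/-- **`dim_ℚ End⁰(J_{20}) = 50` and `dim J_{20} = 9 = g(C_{20})`** (`2 + 16 + 32`; `1 + (2 + 2) + 4`).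
[cite: GalleseGoodsonLombardo2024, §3 Thm. 3.0 and §3.5 Lemma 14 (3)] [cite: MumfordAV1970, §19 Cor. 2 of Thm. 3] -/
theorem finrank_endAlgebra_twentyJacobian (hA₄ : IsCMTypeRealisation Φ₄ A₄ ι₄ θ₄)
    (hΦ₅ : ∀ σ : K₅ →+* ℂ, σ ∈ Φ₅.1 ↔ 2 * (expOf 5 K₅ σ).val < 5) (hA₅ : IsCMTypeRealisation Φ₅ A₅ ι₅ θ₅)
    (hΨ : ∀ σ : L →+* ℂ, σ ∈ Ψ.1 ↔ 2 * (expOf (2 * 5) L σ).val < 2 * 5) (hA₁₀ : IsCMTypeRealisation Ψ A₁₀ ι₁₀ θ₁₀)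
    (hΦ' : ∀ σ : K →+* ℂ, σ ∈ Φ'.1 ↔ 2 * (expOf 20 K σ).val < 20) (hA' : IsCMTypeRealisation Φ' A' ι' θ') :
    finrank ℚ (⨁ fun i : Fin 3 =>
        (![A₄, ⨁ fun l : Fin 2 => (![A₅, A₁₀] : Fin 2 → AbelianVariety ℂ) l, A'] : Fin 3 → AbelianVariety ℂ) i).endAlgebra = 50 ∧
    (⨁ fun i : Fin 3 =>
        (![A₄, ⨁ fun l : Fin 2 => (![A₅, A₁₀] : Fin 2 → AbelianVariety ℂ) l, A'] : Fin 3 → AbelianVariety ℂ) i).dim = 9 := by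
  classical
  haveI : NeZero (5 : ℕ) := ⟨by norm_num⟩
  haveI : NeZero (2 * 5 : ℕ) := ⟨by norm_num⟩
  haveI : NeZero (20 : ℕ) := ⟨by norm_num⟩
  obtain ⟨hd', -, hF, -⟩ := nonempty_matrix_four_algEquiv_endAlgebra_twenty Φ' hΦ' hA'
  refine ⟨?_, ?_⟩
  · obtain ⟨e⟩ := nonempty_endAlgebra_algEquiv_twentyJacobian hA₄ hΦ₅ hA₅ hΨ hA₁₀ hΦ' hA'
    haveI : FiniteDimensional ℚ (IntermediateField.adjoin ℚ {zetaOf 20 K + zetaOf 20 K ^ 3 + zetaOf 20 K ^ 7 + zetaOf 20 K ^ 9}) :=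
      IntermediateField.finiteDimensional_left _
    haveI : Module.Finite ℚ (Matrix (Fin 4) (Fin 4)
        (IntermediateField.adjoin ℚ {zetaOf 20 K + zetaOf 20 K ^ 3 + zetaOf 20 K ^ 7 + zetaOf 20 K ^ 9})) := Module.Finite.matrix
    haveI : Module.Finite ℚ (Matrix (Fin 2) (Fin 2) K₅) := Module.Finite.matrix
    have hK₅ : finrank ℚ K₅ = 4 := by
      rw [IsCyclotomicExtension.finrank (K := ℚ) (n := 5) K₅ (Polynomial.cyclotomic.irreducible_rat (by norm_num))]
      decide +kernel
    rw [e.toLinearEquiv.finrank_eq, Module.finrank_prod, Module.finrank_prod, Module.finrank_matrix, Module.finrank_matrix,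
      Fintype.card_fin, Fintype.card_fin, finrank_eq_two_four'' (K₄ := K₄), hK₅, hF]
  · have hd₄ : A₄.dim = 1 := by
      have h : A₄.dim = finrank ℚ K₄ / 2 := Motives.schemeDim_eq_holds hA₄.1
      rw [finrank_eq_two_four'' (K₄ := K₄)] at h
      simpa using h
    have hd₅ : A₅.dim = 2 := by
      have h : A₅.dim = finrank ℚ K₅ / 2 := Motives.schemeDim_eq_holds hA₅.1
      rw [IsCyclotomicExtension.finrank (K := ℚ) (n := 5) K₅ (Polynomial.cyclotomic.irreducible_rat (by norm_num)),
        show Nat.totient 5 = 4 by decide +kernel] at h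
      simpa using h
    have hd₁₀ : A₁₀.dim = 2 := by
      have h : A₁₀.dim = finrank ℚ L / 2 := Motives.schemeDim_eq_holds hA₁₀.1
      rw [IsCyclotomicExtension.finrank (K := ℚ) (n := 2 * 5) L (Polynomial.cyclotomic.irreducible_rat (by norm_num)),
        show Nat.totient (2 * 5) = 4 by decide +kernel] at h
      simpa using h
    rw [AbelianVariety.dim_biproduct, Fin.sum_univ_three]
    simp only [Matrix.cons_val_zero, Matrix.cons_val_one, Matrix.cons_val_two, Matrix.head_cons, Matrix.tail_cons]
    rw [AbelianVariety.dim_biproduct, Fin.sum_univ_two]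
    simp only [Matrix.cons_val_zero, Matrix.cons_val_one]
    omega

end TwentyJacobian

end HyperellipticJacobian

end Literature.AlgebraicGeometry.ComplexMultiplication

end
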